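import Literature.RingTheory.MvPowerSeries.ConvergentPowerSeries
import Mathlib.RingTheory.PowerSeries.Basic
import Mathlib.RingTheory.PowerSeries.NoZeroDivisors
import Mathlib.Data.Finsupp.Antidiagonal
import Mathlib.Tactic.LinearCombination
import HarnessLib

/-!
# The Weierstrass division and preparation theorems for convergent power series

Topic `Literature/RingTheory/MvPowerSeries`.  Over a complete normed field `𝕜` (e.g. `ℝ`, `ℂ`)
and in the variables `Option σ` with the DISTINGUISHED variable `T = X none` (the others being
`x' = (X (some i))ᵢ`), we prove for CONVERGENT power series (finite weighted `ℓ¹`-norm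
`wnorm ρ`, file `ConvergentPowerSeries.lean`):

* **Weierstrass division** (`weierstrass_division`): if `g` is regular in `T` of order `d`
  (`IsTRegular d g`: `g(T, 0) = T^d · (c + …)`, `c ≠ 0`) and `‖g‖_{ρ₀} < ∞`, then on a smaller
  positive polyradius `ρ ≤ ρ₀` every `f` with `‖f‖_ρ < ∞` is uniquely `f = q g + r` with
  `‖q‖_ρ, ‖r‖_ρ < ∞` and `r` a polynomial in `T` of degree `< d` (`IsTPoly d r`); germ forms
  `exists_weierstrass_division`, `weierstrass_division_unique` for `HasPosRadius`.
* **Weierstrass preparation** (`exists_weierstrass_preparation`): such a `g` is `u · (T^d + b)`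
  with `u` a convergent unit and `b` a convergent polynomial in `T` of degree `< d` all of whose
  coefficients vanish at `x' = 0` (`VanishesOnT b`).

The proof is the Banach-fixed-point ("Stickelberger operator") proof of H. Grauert, R. Remmert,
*Analytische Stellenalgebren* (1971), Kap. I §4, Satz 2 (Weierstraßsche Formel) and Satz 3–4
(Divisionssatz, Vorbereitungssatz), run coefficientwise: write `g = T^d e + b₀` with `e` a unit
and `b₀` of `T`-degree `< d` vanishing at `x' = 0`; dividing by `g e⁻¹ = T^d - w` (`w = -b₀ e⁻¹`,
small after shrinking the `x'`-radii, `anisotropic_shrink`) amounts to the fixed point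
`q = H(f + q w)` of a `½`-contraction of `B_ρ`, where `f = L f + T^d · H f` splits a series
into its part of `T`-degree `< d` and the rest (`lowT`, `highT`); the fixed point is the
coefficientwise sum of the iterates (`divIter`), which converges in every weighted norm.

Everything is proved; no named facts.  (Also: J. M. Ruiz, *The basic theory of power series*
(1993), §2; C. de Jong, G. Pfister, *Local analytic geometry* (2000), Thm. 3.2.3–3.2.4.)

## References

* H. Grauert, R. Remmert, *Analytische Stellenalgebren*, Springer (1971), Kap. I §4,
  Satz 2–4. [GrauertRemmert1971]
* J. M. Ruiz, *The basic theory of power series*, Vieweg (1993), §2. [Ruiz1993]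
* J. Denef, L. van den Dries, *p-adic and real subanalytic sets*, Ann. of Math. 128 (1988),
  §4 (use of Weierstrass preparation for `ℝ{x}`). [DenefvandenDries1988]
-/

noncomputable section

open MvPowerSeries Finsupp Filter
open scoped NNReal ENNReal Topology BigOperators

namespace Literature.RingTheory.MvPowerSeries

variable {σ : Type*} {𝕜 : Type*} [NormedField 𝕜]

/-! ### 1. Slicing a power series along the distinguished variable `T = X none` -/

section Slicing

variable {R : Type*} [CommRing R]

/-- The part of `F` of `T`-degree `< d` (`T = X none`). [cite: GrauertRemmert1971, Kap. I §4] -/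
def lowT (d : ℕ) (F : MvPowerSeries (Option σ) R) : MvPowerSeries (Option σ) R :=
  fun e => if e none < d then coeff e F else 0

/-- The series `H` with `F = lowT d F + T^d · H`. [cite: GrauertRemmert1971, Kap. I §4] -/
def highT (d : ℕ) (F : MvPowerSeries (Option σ) R) : MvPowerSeries (Option σ) R :=
  fun e => coeff (e + single none d) F

/-- Coefficients of `lowT`. [folklore] -/
@[simp] theorem coeff_lowT (d : ℕ) (F : MvPowerSeries (Option σ) R) (e : Option σ →₀ ℕ) :
    coeff e (lowT d F) = if e none < d then coeff e F else 0 := rfl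

/-- Coefficients of `highT`. [folklore] -/
@[simp] theorem coeff_highT (d : ℕ) (F : MvPowerSeries (Option σ) R) (e : Option σ →₀ ℕ) :
    coeff e (highT d F) = coeff (e + single none d) F := rfl

/-- `lowT` is additive. [folklore] -/
theorem lowT_add (d : ℕ) (F G : MvPowerSeries (Option σ) R) :
    lowT d (F + G) = lowT d F + lowT d G := by
  ext e; simp only [coeff_lowT, map_add]; split_ifs <;> simp

/-- `highT` is additive. [folklore] -/
theorem highT_add (d : ℕ) (F G : MvPowerSeries (Option σ) R) :
    highT d (F + G) = highT d F + highT d G := by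
  ext e; simp only [coeff_highT, map_add]

/-- `lowT` of zero. [folklore] -/
@[simp] theorem lowT_zero (d : ℕ) : lowT d (0 : MvPowerSeries (Option σ) R) = 0 := by
  ext e; simp

/-- `highT` of zero. [folklore] -/
@[simp] theorem highT_zero (d : ℕ) : highT d (0 : MvPowerSeries (Option σ) R) = 0 := by
  ext e; simp

/-- `lowT` is `R`-homogeneous. [folklore] -/
theorem lowT_smul (d : ℕ) (c : R) (F : MvPowerSeries (Option σ) R) :
    lowT d (c • F) = c • lowT d F := by
  ext e; simp only [coeff_lowT, map_smul, smul_eq_mul]; split_ifs <;> simp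

/-- `highT` is `R`-homogeneous. [folklore] -/
theorem highT_smul (d : ℕ) (c : R) (F : MvPowerSeries (Option σ) R) :
    highT d (c • F) = c • highT d F := by
  ext e; simp only [coeff_highT, map_smul]

/-- `lowT (F - G) = lowT F - lowT G`. [folklore] -/
theorem lowT_sub (d : ℕ) (F G : MvPowerSeries (Option σ) R) :
    lowT d (F - G) = lowT d F - lowT d G := by
  ext e; simp only [coeff_lowT, map_sub]; split_ifs <;> simp

/-- `highT (F - G) = highT F - highT G`. [folklore] -/
theorem highT_sub (d : ℕ) (F G : MvPowerSeries (Option σ) R) :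
    highT d (F - G) = highT d F - highT d G := by
  ext e; simp only [coeff_highT, map_sub]

/-- Coefficients of `T^d · G`. [folklore] -/
theorem coeff_X_none_pow_mul (d : ℕ) (G : MvPowerSeries (Option σ) R) (e : Option σ →₀ ℕ) :
    coeff e ((X none : MvPowerSeries (Option σ) R) ^ d * G) =
      if d ≤ e none then coeff (e - single none d) G else 0 := by
  rw [X_pow_eq, coeff_monomial_mul, one_mul]
  by_cases h : d ≤ e none
  · rw [if_pos (Finsupp.single_le_iff.mpr h), if_pos h]
  · rw [if_neg (fun h' => h (Finsupp.single_le_iff.mp h')), if_neg h]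

/-- **The splitting `F = lowT d F + T^d · highT d F`.** [cite: GrauertRemmert1971, Kap. I §4] -/
theorem lowT_add_X_pow_mul_highT (d : ℕ) (F : MvPowerSeries (Option σ) R) :
    lowT d F + (X none : MvPowerSeries (Option σ) R) ^ d * highT d F = F := by
  ext e
  rw [map_add, coeff_lowT, coeff_X_none_pow_mul]
  by_cases h : e none < d
  · rw [if_pos h, if_neg (not_le.mpr h), add_zero]
  · rw [if_neg h, if_pos (not_lt.mp h), zero_add, coeff_highT,
      tsub_add_cancel_of_le (Finsupp.single_le_iff.mpr (not_lt.mp h))]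

/-- `highT d (T^d · G) = G`. [folklore] -/
theorem highT_X_pow_mul (d : ℕ) (G : MvPowerSeries (Option σ) R) :
    highT d ((X none : MvPowerSeries (Option σ) R) ^ d * G) = G := by
  ext e
  rw [coeff_highT, coeff_X_none_pow_mul, if_pos (by simp), add_tsub_cancel_right]

/-- `lowT d (T^d · G) = 0`. [folklore] -/
theorem lowT_X_pow_mul (d : ℕ) (G : MvPowerSeries (Option σ) R) :
    lowT d ((X none : MvPowerSeries (Option σ) R) ^ d * G) = 0 := by
  ext e
  rw [coeff_lowT, coeff_X_none_pow_mul]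
  by_cases h : e none < d
  · rw [if_pos h, if_neg (not_le.mpr h), coeff_zero]
  · rw [if_neg h, coeff_zero]

/-- A series is a **polynomial in `T` of degree `< d`** (with power-series coefficients in `x'`).
[cite: GrauertRemmert1971, Kap. I §4] -/
def IsTPoly (d : ℕ) (F : MvPowerSeries (Option σ) R) : Prop :=
  ∀ e : Option σ →₀ ℕ, d ≤ e none → coeff e F = 0

/-- `lowT d F` has `T`-degree `< d`. [folklore] -/
theorem isTPoly_lowT (d : ℕ) (F : MvPowerSeries (Option σ) R) : IsTPoly d (lowT d F) := by
  intro e he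
  rw [coeff_lowT, if_neg (not_lt.mpr he)]

/-- `F` has `T`-degree `< d` iff `lowT d F = F`. [folklore] -/
theorem isTPoly_iff_lowT_eq (d : ℕ) (F : MvPowerSeries (Option σ) R) :
    IsTPoly d F ↔ lowT d F = F := by
  constructor
  · intro h; ext e; rw [coeff_lowT]
    by_cases he : e none < d
    · rw [if_pos he]
    · rw [if_neg he, h e (not_lt.mp he)]
  · intro h; rw [← h]; exact isTPoly_lowT d F

/-- `F` has `T`-degree `< d` iff `highT d F = 0`. [folklore] -/
theorem isTPoly_iff_highT_eq_zero (d : ℕ) (F : MvPowerSeries (Option σ) R) :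
    IsTPoly d F ↔ highT d F = 0 := by
  constructor
  · intro h; ext e; rw [coeff_highT, coeff_zero]; exact h _ (by simp)
  · intro h e he
    have h1 := congrArg (coeff (e - single none d)) h
    rw [coeff_highT, coeff_zero, tsub_add_cancel_of_le (Finsupp.single_le_iff.mpr he)] at h1
    exact h1

/-- Zero is a `T`-polynomial of every degree bound. [folklore] -/
theorem isTPoly_zero (d : ℕ) : IsTPoly d (0 : MvPowerSeries (Option σ) R) := fun _ _ => rfl

/-- `IsTPoly` is closed under addition. [folklore] -/
theorem IsTPoly.add {d : ℕ} {F G : MvPowerSeries (Option σ) R} (hF : IsTPoly d F) (hG : IsTPoly d G) :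
    IsTPoly d (F + G) := fun e he => by rw [map_add, hF e he, hG e he, add_zero]

/-- `IsTPoly` is closed under negation. [folklore] -/
theorem IsTPoly.neg {d : ℕ} {F : MvPowerSeries (Option σ) R} (hF : IsTPoly d F) : IsTPoly d (-F) :=
  fun e he => by rw [map_neg, hF e he, neg_zero]

/-- `IsTPoly` is closed under subtraction. [folklore] -/
theorem IsTPoly.sub {d : ℕ} {F G : MvPowerSeries (Option σ) R} (hF : IsTPoly d F) (hG : IsTPoly d G) :
    IsTPoly d (F - G) := fun e he => by rw [map_sub, hF e he, hG e he, sub_zero]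

/-- `IsTPoly` is closed under multiplication by series in `x'` only... more generally it is
monotone in the bound. [folklore] -/
theorem IsTPoly.mono {d d' : ℕ} (h : d ≤ d') {F : MvPowerSeries (Option σ) R} (hF : IsTPoly d F) :
    IsTPoly d' F := fun e he => hF e (h.trans he)

/-- Uniqueness of the splitting: if `F = P + T^d G` with `P` of `T`-degree `< d` then
`G = highT d F` and `P = lowT d F`. [cite: GrauertRemmert1971, Kap. I §4] -/
theorem eq_highT_of_add_eq {d : ℕ} {F P G : MvPowerSeries (Option σ) R} (hP : IsTPoly d P)
    (h : P + (X none : MvPowerSeries (Option σ) R) ^ d * G = F) :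
    G = highT d F ∧ P = lowT d F := by
  have hG : G = highT d F := by
    rw [← h, highT_add, highT_X_pow_mul, (isTPoly_iff_highT_eq_zero d P).mp hP, zero_add]
  refine ⟨hG, ?_⟩
  have h2 := lowT_add_X_pow_mul_highT d F
  rw [← hG] at h2
  exact add_right_cancel (h.trans h2.symm)

/-- **Regularity in `T` of order `d`**: `g(T, x' = 0) = T^d (c + O(T))` with `c ≠ 0`, i.e. the
pure-`T` coefficients of `g` vanish below degree `d` and the `T^d`-coefficient is non-zero.
[cite: GrauertRemmert1971, Kap. I §4] -/
def IsTRegular (d : ℕ) (g : MvPowerSeries (Option σ) R) : Prop :=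
  (∀ k < d, coeff (single none k) g = 0) ∧ coeff (single none d) g ≠ 0

/-- **Vanishing at `x' = 0`**: all pure-`T` coefficients vanish, i.e. every monomial of `F`
involves some `x'ᵢ`. [cite: GrauertRemmert1971, Kap. I §4] -/
def VanishesOnT (F : MvPowerSeries (Option σ) R) : Prop :=
  ∀ k : ℕ, coeff (single none k) F = 0

/-- An exponent is pure-`T` iff its `x'`-part vanishes. [folklore] -/
theorem eq_single_none_iff (e : Option σ →₀ ℕ) : e = single none (e none) ↔ e.some = 0 := by
  constructor
  · intro h; rw [h]; ext s; simp
  · intro h; ext o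
    rcases o with _ | s
    · simp
    · have := DFunLike.congr_fun h s
      simpa [Finsupp.single_apply] using this

/-- `VanishesOnT F` iff every coefficient with vanishing `x'`-exponent is zero. [folklore] -/
theorem vanishesOnT_iff (F : MvPowerSeries (Option σ) R) :
    VanishesOnT F ↔ ∀ e : Option σ →₀ ℕ, e.some = 0 → coeff e F = 0 := by
  constructor
  · intro h e he; rw [(eq_single_none_iff e).mpr he]; exact h _
  · intro h k; exact h _ (by simp)

/-- `VanishesOnT` is an ideal condition: stable under multiplication by anything. [folklore] -/
theorem VanishesOnT.mul_right {F : MvPowerSeries (Option σ) R} (hF : VanishesOnT F)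
    (G : MvPowerSeries (Option σ) R) : VanishesOnT (F * G) := by
  classical
  rw [vanishesOnT_iff] at hF ⊢
  intro e he
  rw [coeff_mul]
  refine Finset.sum_eq_zero fun p hp => ?_
  have hp' : p.1 + p.2 = e := Finset.mem_antidiagonal.mp hp
  have h1 : p.1.some = 0 := by
    have := congrArg Finsupp.some hp'
    rw [Finsupp.some_add, he] at this
    exact le_antisymm (le_of_le_of_eq le_self_add this) zero_le
  rw [hF _ h1, zero_mul]

/-- `VanishesOnT` is stable under left multiplication. [folklore] -/
theorem VanishesOnT.mul_left {F : MvPowerSeries (Option σ) R} (hF : VanishesOnT F)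
    (G : MvPowerSeries (Option σ) R) : VanishesOnT (G * F) := by
  rw [mul_comm]; exact hF.mul_right G

/-- `VanishesOnT` is stable under addition. [folklore] -/
theorem VanishesOnT.add {F G : MvPowerSeries (Option σ) R} (hF : VanishesOnT F) (hG : VanishesOnT G) :
    VanishesOnT (F + G) := fun k => by rw [map_add, hF, hG, add_zero]

/-- `VanishesOnT` is stable under negation. [folklore] -/
theorem VanishesOnT.neg {F : MvPowerSeries (Option σ) R} (hF : VanishesOnT F) : VanishesOnT (-F) :=
  fun k => by rw [map_neg, hF, neg_zero]

/-- `VanishesOnT` passes to `lowT`. [folklore] -/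
theorem VanishesOnT.lowT {F : MvPowerSeries (Option σ) R} (hF : VanishesOnT F) (d : ℕ) :
    VanishesOnT (lowT d F) := fun k => by
  rw [coeff_lowT]; split_ifs <;> simp [hF k]

/-- The constant coefficient of `highT d g` is the `T^d`-coefficient of `g`. [folklore] -/
theorem constantCoeff_highT (d : ℕ) (g : MvPowerSeries (Option σ) R) :
    constantCoeff (highT d g) = coeff (single none d) g := by
  rw [← coeff_zero_eq_constantCoeff_apply, coeff_highT, zero_add]

/-- For a `T`-regular `g` of order `d`, the low part `lowT d g` vanishes at `x' = 0`. [folklore] -/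
theorem IsTRegular.vanishesOnT_lowT {d : ℕ} {g : MvPowerSeries (Option σ) R} (hg : IsTRegular d g) :
    VanishesOnT (lowT d g) := by
  intro k
  rw [coeff_lowT]
  by_cases hk : (single none k : Option σ →₀ ℕ) none < d
  · rw [if_pos hk]; exact hg.1 k (by simpa using hk)
  · rw [if_neg hk]

end Slicing

/-! ### 2. Norm estimates for the slicing operators -/

section Estimates

/-- `‖lowT d F‖_ρ ≤ ‖F‖_ρ`. [folklore] -/
theorem wnorm_lowT_le (ρ : Option σ → ℝ≥0) (d : ℕ) (F : MvPowerSeries (Option σ) 𝕜) :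
    wnorm ρ (lowT d F) ≤ wnorm ρ F := by
  refine ENNReal.tsum_le_tsum fun e => ENNReal.coe_le_coe.mpr ?_
  rw [coeff_lowT]
  split_ifs
  · exact le_rfl
  · simp

/-- `‖highT d F‖_ρ · ρ_T ^ d ≤ ‖F‖_ρ`. [cite: GrauertRemmert1971, Kap. I §4] -/
theorem wnorm_highT_mul_le (ρ : Option σ → ℝ≥0) (d : ℕ) (F : MvPowerSeries (Option σ) 𝕜) :
    wnorm ρ (highT d F) * (ρ none : ℝ≥0∞) ^ d ≤ wnorm ρ F := by
  unfold wnorm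
  rw [← ENNReal.tsum_mul_right]
  calc ∑' e, ((‖coeff e (highT d F)‖₊ * wt ρ e : ℝ≥0) : ℝ≥0∞) * (ρ none : ℝ≥0∞) ^ d
      = ∑' e, ((‖coeff (e + single none d) F‖₊ * wt ρ (e + single none d) : ℝ≥0) : ℝ≥0∞) := by
        refine tsum_congr fun e => ?_
        rw [coeff_highT, wt_add, wt_single, ← ENNReal.coe_pow, ← ENNReal.coe_mul, mul_assoc]
    _ ≤ ∑' e, ((‖coeff e F‖₊ * wt ρ e : ℝ≥0) : ℝ≥0∞) :=
        ENNReal.tsum_comp_le_tsum_of_injective (add_left_injective (single none d))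
          (fun e => ((‖coeff e F‖₊ * wt ρ e : ℝ≥0) : ℝ≥0∞))

/-- `‖highT d F‖_ρ ≤ ‖F‖_ρ / ρ_T ^ d` (for `ρ_T ≠ 0`). [cite: GrauertRemmert1971, Kap. I §4] -/
theorem wnorm_highT_le {ρ : Option σ → ℝ≥0} (hr : ρ none ≠ 0) (d : ℕ)
    (F : MvPowerSeries (Option σ) 𝕜) :
    wnorm ρ (highT d F) ≤ wnorm ρ F / (ρ none : ℝ≥0∞) ^ d := by
  rw [ENNReal.le_div_iff_mul_le (Or.inl (pow_ne_zero _ (ENNReal.coe_ne_zero.mpr hr)))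
    (Or.inl (ENNReal.pow_ne_top ENNReal.coe_ne_top))]
  exact wnorm_highT_mul_le ρ d F

/-- `‖T^d · G‖_ρ ≤ ρ_T ^ d ‖G‖_ρ`. [folklore] -/
theorem wnorm_X_pow_mul_le (ρ : Option σ → ℝ≥0) (d : ℕ) (G : MvPowerSeries (Option σ) 𝕜) :
    wnorm ρ ((X none : MvPowerSeries (Option σ) 𝕜) ^ d * G) ≤ (ρ none : ℝ≥0∞) ^ d * wnorm ρ G := by
  refine (wnorm_mul_le ρ _ _).trans (mul_le_mul_of_nonneg_right ?_ zero_le)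
  refine (wnorm_pow_le ρ _ _).trans ?_
  rw [wnorm_X]

/-- The polyradius with the `x'`-radii scaled by `t` (the `T`-radius unchanged). [folklore] -/
def scaleSome (t : ℝ≥0) (ρ : Option σ → ℝ≥0) : Option σ → ℝ≥0 :=
  fun o => Option.elim o (ρ none) fun i => t * ρ (some i)

/-- The `T`-radius of `scaleSome t ρ`. [folklore] -/
@[simp] theorem scaleSome_none (t : ℝ≥0) (ρ : Option σ → ℝ≥0) : scaleSome t ρ none = ρ none := rfl

/-- The `x'ᵢ`-radius of `scaleSome t ρ`. [folklore] -/
@[simp] theorem scaleSome_some (t : ℝ≥0) (ρ : Option σ → ℝ≥0) (i : σ) :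
    scaleSome t ρ (some i) = t * ρ (some i) := rfl

/-- `scaleSome t ρ ≤ ρ` for `t ≤ 1`. [folklore] -/
theorem scaleSome_le {t : ℝ≥0} (ht : t ≤ 1) (ρ : Option σ → ℝ≥0) (o : Option σ) :
    scaleSome t ρ o ≤ ρ o := by
  rcases o with _ | i
  · exact le_rfl
  · exact mul_le_of_le_one_left zero_le ht

/-- `scaleSome t ρ` is positive when `t` and `ρ` are. [folklore] -/
theorem scaleSome_pos {t : ℝ≥0} (ht : 0 < t) {ρ : Option σ → ℝ≥0} (hρ : ∀ o, 0 < ρ o) (o : Option σ) :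
    0 < scaleSome t ρ o := by
  rcases o with _ | i
  · exact hρ none
  · exact mul_pos ht (hρ _)

/-- Weight of a monomial involving some `x'ᵢ` under `scaleSome t`: at most `t` times the old
weight (`t ≤ 1`). [folklore] -/
theorem wt_scaleSome_le {t : ℝ≥0} (ht : t ≤ 1) (ρ : Option σ → ℝ≥0) {e : Option σ →₀ ℕ}
    (he : e.some ≠ 0) : wt (scaleSome t ρ) e ≤ t * wt ρ e := by
  classical
  -- pick a variable `some i` occurring in `e`
  obtain ⟨i, hi⟩ : ∃ i, e (some i) ≠ 0 := by
    by_contra h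
    push Not at h
    exact he (Finsupp.ext fun i => by simpa using h i)
  have hmem : some i ∈ e.support := Finsupp.mem_support_iff.mpr hi
  rw [wt_eq_prod, wt_eq_prod, ← Finset.mul_prod_erase _ _ hmem, ← Finset.mul_prod_erase _ _ hmem,
    ← mul_assoc]
  refine mul_le_mul ?_ ?_ zero_le zero_le
  · rw [scaleSome_some, mul_pow]
    refine mul_le_mul ?_ le_rfl zero_le zero_le
    calc t ^ e (some i) ≤ t ^ 1 := pow_le_pow_of_le_one zero_le ht (Nat.one_le_iff_ne_zero.mpr hi)
      _ = t := pow_one t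
  · exact Finset.prod_le_prod (fun o _ => zero_le) fun o _ =>
      pow_le_pow_left₀ zero_le (scaleSome_le ht ρ o) _

/-- **Anisotropic shrinking**: a series vanishing at `x' = 0` becomes small when only the
`x'`-radii are shrunk: `‖F‖_{scaleSome t ρ} ≤ t ‖F‖_ρ` for `t ≤ 1`.
[cite: GrauertRemmert1971, Kap. I §4] -/
theorem wnorm_scaleSome_le {t : ℝ≥0} (ht : t ≤ 1) (ρ : Option σ → ℝ≥0)
    {F : MvPowerSeries (Option σ) 𝕜} (hF : VanishesOnT F) :
    wnorm (scaleSome t ρ) F ≤ t * wnorm ρ F := by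
  unfold wnorm
  rw [← ENNReal.tsum_mul_left]
  refine ENNReal.tsum_le_tsum fun e => ?_
  by_cases he : e.some = 0
  · rw [(vanishesOnT_iff F).mp hF e he]; simp
  · rw [← ENNReal.coe_mul, ENNReal.coe_le_coe, mul_left_comm]
    exact mul_le_mul_of_nonneg_left (wt_scaleSome_le ht ρ he) zero_le

end Estimates



/-! ### 3. Division by `T^d - w` for small `w`: the contraction -/

section Contraction

open MvPowerSeries.WithPiTopology

/-- The **contraction operator** `L q = highT d (q · w)` of the division by `T^d - w`.
[cite: GrauertRemmert1971, Kap. I §4, Satz 2] -/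
def divOp (d : ℕ) (w q : MvPowerSeries (Option σ) 𝕜) : MvPowerSeries (Option σ) 𝕜 :=
  highT d (q * w)

/-- `(a / 2) / a = 2⁻¹` in `ℝ≥0∞` for `a ≠ 0, ∞`. [folklore] -/
theorem ENNReal.div_two_div_self {a : ℝ≥0∞} (h0 : a ≠ 0) (ht : a ≠ ⊤) : a / 2 / a = 2⁻¹ := by
  rw [div_eq_mul_inv, div_eq_mul_inv, mul_comm a, mul_assoc, ENNReal.mul_inv_cancel h0 ht, mul_one]

/-- **`L` halves the norm**: `‖L q‖_ρ ≤ ‖q‖_ρ / 2` when `‖w‖_ρ ≤ ρ_T^d / 2`.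
[cite: GrauertRemmert1971, Kap. I §4, Satz 2] -/
theorem wnorm_divOp_le {ρ : Option σ → ℝ≥0} (hr : ρ none ≠ 0) {d : ℕ} {w : MvPowerSeries (Option σ) 𝕜}
    (hw : wnorm ρ w ≤ (ρ none : ℝ≥0∞) ^ d / 2) (q : MvPowerSeries (Option σ) 𝕜) :
    wnorm ρ (divOp d w q) ≤ wnorm ρ q / 2 := by
  have hrd0 : (ρ none : ℝ≥0∞) ^ d ≠ 0 := pow_ne_zero _ (ENNReal.coe_ne_zero.mpr hr)
  have hrdt : (ρ none : ℝ≥0∞) ^ d ≠ ⊤ := ENNReal.pow_ne_top ENNReal.coe_ne_top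
  unfold divOp
  calc wnorm ρ (highT d (q * w))
      ≤ wnorm ρ (q * w) / (ρ none : ℝ≥0∞) ^ d := wnorm_highT_le hr d _
    _ ≤ wnorm ρ q * wnorm ρ w / (ρ none : ℝ≥0∞) ^ d :=
        ENNReal.div_le_div_right (wnorm_mul_le ρ q w) _
    _ ≤ wnorm ρ q * ((ρ none : ℝ≥0∞) ^ d / 2) / (ρ none : ℝ≥0∞) ^ d :=
        ENNReal.div_le_div_right (mul_le_mul_of_nonneg_left hw zero_le) _
    _ = wnorm ρ q / 2 := by
        rw [mul_div_assoc, ENNReal.div_two_div_self hrd0 hrdt, div_eq_mul_inv]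

/-- The **iterates** `L^m (highT d f)` of the contraction. [cite: GrauertRemmert1971, Kap. I §4] -/
def divIter (d : ℕ) (w f : MvPowerSeries (Option σ) 𝕜) (m : ℕ) : MvPowerSeries (Option σ) 𝕜 :=
  (divOp d w)^[m] (highT d f)

/-- `divIter 0 = highT d f`. [folklore] -/
@[simp] theorem divIter_zero (d : ℕ) (w f : MvPowerSeries (Option σ) 𝕜) :
    divIter d w f 0 = highT d f := rfl

/-- `divIter (m+1) = L (divIter m)`. [folklore] -/
theorem divIter_succ (d : ℕ) (w f : MvPowerSeries (Option σ) 𝕜) (m : ℕ) :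
    divIter d w f (m + 1) = divOp d w (divIter d w f m) := by
  unfold divIter; rw [Function.iterate_succ_apply']

/-- **Geometric decay of the iterates**: `‖L^m (highT d f)‖_ρ ≤ ‖highT d f‖_ρ / 2^m`.
[cite: GrauertRemmert1971, Kap. I §4, Satz 2] -/
theorem wnorm_divIter_le {ρ : Option σ → ℝ≥0} (hr : ρ none ≠ 0) {d : ℕ} {w : MvPowerSeries (Option σ) 𝕜}
    (hw : wnorm ρ w ≤ (ρ none : ℝ≥0∞) ^ d / 2) (f : MvPowerSeries (Option σ) 𝕜) (m : ℕ) :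
    wnorm ρ (divIter d w f m) ≤ wnorm ρ (highT d f) * (2⁻¹) ^ m := by
  induction m with
  | zero => simp
  | succ m ih =>
    rw [divIter_succ]
    refine (wnorm_divOp_le hr hw _).trans ?_
    rw [div_eq_mul_inv, pow_succ, ← mul_assoc]
    exact mul_le_mul_of_nonneg_right ih zero_le

/-- The **solution of the fixed-point equation** `q = highT d f + L q`: the coefficientwise sum of
the iterates. [cite: GrauertRemmert1971, Kap. I §4, Satz 2] -/
def divSol (d : ℕ) (w f : MvPowerSeries (Option σ) 𝕜) : MvPowerSeries (Option σ) 𝕜 :=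
  fun e => ∑' m, coeff e (divIter d w f m)

/-- Coefficients of `divSol`. [folklore] -/
theorem coeff_divSol (d : ℕ) (w f : MvPowerSeries (Option σ) 𝕜) (e : Option σ →₀ ℕ) :
    coeff e (divSol d w f) = ∑' m, coeff e (divIter d w f m) := rfl

/-- `highT d` is compatible with coefficientwise sums. [folklore] -/
theorem hasSum_highT {ι : Type*} {u : ι → MvPowerSeries (Option σ) 𝕜} {a : MvPowerSeries (Option σ) 𝕜}
    (h : HasSum u a) (d : ℕ) : HasSum (fun i => highT d (u i)) (highT d a) := by
  rw [hasSum_iff_hasSum_coeff] at h ⊢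
  intro e
  simpa only [coeff_highT] using h (e + single none d)

variable [CompleteSpace 𝕜]

/-- Coefficientwise summability of the iterates (all radii positive, `‖f‖_ρ < ∞`). [folklore] -/
theorem summable_coeff_divIter {ρ : Option σ → ℝ≥0} (hρ : ∀ o, 0 < ρ o) {d : ℕ}
    {w : MvPowerSeries (Option σ) 𝕜} (hw : wnorm ρ w ≤ (ρ none : ℝ≥0∞) ^ d / 2)
    {f : MvPowerSeries (Option σ) 𝕜} (hf : wnorm ρ f < ⊤) (e : Option σ →₀ ℕ) :
    Summable fun m => coeff e (divIter d w f m) := by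
  have hr : ρ none ≠ 0 := (hρ none).ne'
  have hH : wnorm ρ (highT d f) < ⊤ :=
    (wnorm_highT_le hr d f).trans_lt (ENNReal.div_lt_top hf.ne (pow_ne_zero _ (ENNReal.coe_ne_zero.mpr hr)))
  set A : ℝ≥0 := (wnorm ρ (highT d f)).toNNReal with hA
  have hAeq : wnorm ρ (highT d f) = A := (ENNReal.coe_toNNReal hH.ne).symm
  have hwt : 0 < wt ρ e := wt_pos hρ e
  -- real bound `‖coeff e (divIter m)‖ ≤ (A / wt ρ e) * (1/2)^m`
  refine Summable.of_norm_bounded (g := fun m : ℕ => (A / wt ρ e : ℝ) * ((1 : ℝ) / 2) ^ m)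
    (summable_geometric_two.mul_left _) fun m => ?_
  have h1 := coeff_mul_wt_le_wnorm ρ (divIter d w f m) e
  have h2 := (h1.trans (wnorm_divIter_le hr hw f m))
  rw [hAeq, ← ENNReal.coe_two, ← ENNReal.coe_inv two_ne_zero, ← ENNReal.coe_pow,
    ← ENNReal.coe_mul, ENNReal.coe_le_coe] at h2
  -- pass to ℝ
  have h3 : (‖coeff e (divIter d w f m)‖₊ : ℝ) * wt ρ e ≤ A * (2⁻¹ : ℝ) ^ m := by
    have := NNReal.coe_le_coe.mpr h2
    push_cast at this
    exact this
  rw [coe_nnnorm] at h3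
  rw [div_mul_eq_mul_div, le_div_iff₀ (by exact_mod_cast hwt), one_div]
  linarith [h3]

/-- The iterates sum to `divSol` in the topology of coefficientwise convergence. [folklore] -/
theorem hasSum_divIter {ρ : Option σ → ℝ≥0} (hρ : ∀ o, 0 < ρ o) {d : ℕ}
    {w : MvPowerSeries (Option σ) 𝕜} (hw : wnorm ρ w ≤ (ρ none : ℝ≥0∞) ^ d / 2)
    {f : MvPowerSeries (Option σ) 𝕜} (hf : wnorm ρ f < ⊤) :
    HasSum (divIter d w f) (divSol d w f) := by
  rw [hasSum_iff_hasSum_coeff]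
  intro e
  rw [coeff_divSol]
  exact (summable_coeff_divIter hρ hw hf e).hasSum

/-- **Norm bound for the solution**: `‖q‖_ρ ≤ 2 ‖highT d f‖_ρ`. [cite: GrauertRemmert1971, Kap. I §4] -/
theorem wnorm_divSol_le {ρ : Option σ → ℝ≥0} (hρ : ∀ o, 0 < ρ o) {d : ℕ}
    {w : MvPowerSeries (Option σ) 𝕜} (hw : wnorm ρ w ≤ (ρ none : ℝ≥0∞) ^ d / 2)
    {f : MvPowerSeries (Option σ) 𝕜} (hf : wnorm ρ f < ⊤) :
    wnorm ρ (divSol d w f) ≤ 2 * wnorm ρ (highT d f) := by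
  have hr : ρ none ≠ 0 := (hρ none).ne'
  rw [← (hasSum_divIter hρ hw hf).tsum_eq]
  refine (wnorm_tsum_le ρ (hasSum_divIter hρ hw hf).summable).trans ?_
  calc ∑' m, wnorm ρ (divIter d w f m) ≤ ∑' m : ℕ, wnorm ρ (highT d f) * (2⁻¹) ^ m :=
        ENNReal.tsum_le_tsum fun m => wnorm_divIter_le hr hw f m
    _ = wnorm ρ (highT d f) * 2 := by
        rw [ENNReal.tsum_mul_left, ENNReal.tsum_geometric, ENNReal.one_sub_inv_two, inv_inv]
    _ = 2 * wnorm ρ (highT d f) := mul_comm _ _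

/-- The solution has finite norm. [folklore] -/
theorem wnorm_divSol_lt_top {ρ : Option σ → ℝ≥0} (hρ : ∀ o, 0 < ρ o) {d : ℕ}
    {w : MvPowerSeries (Option σ) 𝕜} (hw : wnorm ρ w ≤ (ρ none : ℝ≥0∞) ^ d / 2)
    {f : MvPowerSeries (Option σ) 𝕜} (hf : wnorm ρ f < ⊤) :
    wnorm ρ (divSol d w f) < ⊤ := by
  have hr : ρ none ≠ 0 := (hρ none).ne'
  have hH : wnorm ρ (highT d f) < ⊤ :=
    (wnorm_highT_le hr d f).trans_lt (ENNReal.div_lt_top hf.ne (pow_ne_zero _ (ENNReal.coe_ne_zero.mpr hr)))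
  exact (wnorm_divSol_le hρ hw hf).trans_lt (ENNReal.mul_lt_top (by simp) hH)

/-- **The fixed-point equation** `q = highT d f + L q` for `q = divSol d w f`.
[cite: GrauertRemmert1971, Kap. I §4, Satz 2] -/
theorem divSol_eq {ρ : Option σ → ℝ≥0} (hρ : ∀ o, 0 < ρ o) {d : ℕ}
    {w : MvPowerSeries (Option σ) 𝕜} (hw : wnorm ρ w ≤ (ρ none : ℝ≥0∞) ^ d / 2)
    {f : MvPowerSeries (Option σ) 𝕜} (hf : wnorm ρ f < ⊤) :
    divSol d w f = highT d f + divOp d w (divSol d w f) := by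
  have h := hasSum_divIter hρ hw hf
  -- `L` applied termwise: `L (divIter m) = divIter (m+1)` sums to `L q`
  have hL : HasSum (fun m => divIter d w f (m + 1)) (divOp d w (divSol d w f)) := by
    have h1 : HasSum (fun m => divIter d w f m * w) (divSol d w f * w) := h.mul_right w
    have h2 := hasSum_highT h1 d
    simp_rw [divIter_succ]
    exact h2
  -- the shifted series sums to `q - divIter 0`
  have hshift : HasSum (fun m => divIter d w f (m + 1)) (divSol d w f - divIter d w f 0) := by
    have := (hasSum_nat_add_iff' (f := divIter d w f) 1).mpr h
    simpa only [Finset.range_one, Finset.sum_singleton] using this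
  have heq := hL.unique hshift
  rw [divIter_zero] at heq
  rw [heq, add_sub_cancel]

/-- **Existence of the division by `T^d - w`** (small `w`): for `‖f‖_ρ < ∞` the series
`q = divSol d w f` and `r = lowT d (f + q w)` satisfy `f = q (T^d - w) + r` with
`‖q‖_ρ, ‖r‖_ρ < ∞` and `r` of `T`-degree `< d`. [cite: GrauertRemmert1971, Kap. I §4, Satz 2] -/
theorem division_sub {ρ : Option σ → ℝ≥0} (hρ : ∀ o, 0 < ρ o) {d : ℕ}
    {w : MvPowerSeries (Option σ) 𝕜} (hw : wnorm ρ w ≤ (ρ none : ℝ≥0∞) ^ d / 2) (hwf : wnorm ρ w < ⊤)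
    {f : MvPowerSeries (Option σ) 𝕜} (hf : wnorm ρ f < ⊤) :
    f = divSol d w f * ((X none : MvPowerSeries (Option σ) 𝕜) ^ d - w) +
        lowT d (f + divSol d w f * w) ∧
      wnorm ρ (divSol d w f) < ⊤ ∧ wnorm ρ (lowT d (f + divSol d w f * w)) < ⊤ ∧
      IsTPoly d (lowT d (f + divSol d w f * w)) := by
  set q := divSol d w f with hq
  have hfix : q = highT d f + highT d (q * w) := divSol_eq hρ hw hf
  refine ⟨?_, wnorm_divSol_lt_top hρ hw hf, ?_, isTPoly_lowT d _⟩
  · have hsplit := lowT_add_X_pow_mul_highT d (f + q * w)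
    rw [highT_add, ← hfix] at hsplit
    -- `f + q w = lowT d (f + q w) + T^d q`
    linear_combination -hsplit
  · refine (wnorm_lowT_le ρ d _).trans_lt ?_
    refine (wnorm_add_le ρ _ _).trans_lt (ENNReal.add_lt_top.mpr ⟨hf, ?_⟩)
    exact (wnorm_mul_le ρ _ _).trans_lt (ENNReal.mul_lt_top (wnorm_divSol_lt_top hρ hw hf) hwf)

omit [CompleteSpace 𝕜] in
/-- **Uniqueness of the division by `T^d - w`** in `B_ρ`: if `q (T^d - w) + r = 0` with
`‖q‖_ρ < ∞` and `r` of `T`-degree `< d`, then `q = 0` and `r = 0`.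
[cite: GrauertRemmert1971, Kap. I §4, Satz 2] -/
theorem division_sub_unique_zero {ρ : Option σ → ℝ≥0} (hρ : ∀ o, 0 < ρ o) {d : ℕ}
    {w : MvPowerSeries (Option σ) 𝕜} (hw : wnorm ρ w ≤ (ρ none : ℝ≥0∞) ^ d / 2)
    {q r : MvPowerSeries (Option σ) 𝕜} (hq : wnorm ρ q < ⊤) (hr : IsTPoly d r)
    (h : q * ((X none : MvPowerSeries (Option σ) 𝕜) ^ d - w) + r = 0) : q = 0 ∧ r = 0 := by
  have hr0 : ρ none ≠ 0 := (hρ none).ne'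
  -- `T^d q = q w - r`, hence `q = highT d (q w) = L q`
  have h1 : (X none : MvPowerSeries (Option σ) 𝕜) ^ d * q = q * w - r := by linear_combination h
  have h2 : q = divOp d w q := by
    have := congrArg (highT d) h1
    rw [highT_X_pow_mul, highT_sub, (isTPoly_iff_highT_eq_zero d r).mp hr, sub_zero] at this
    exact this
  have h3 : wnorm ρ q ≤ wnorm ρ q / 2 := by
    conv_lhs => rw [h2]
    exact wnorm_divOp_le hr0 hw q
  have h4 : wnorm ρ q = 0 := by
    have h5 : wnorm ρ q + wnorm ρ q ≤ wnorm ρ q + 0 := by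
      calc wnorm ρ q + wnorm ρ q ≤ wnorm ρ q / 2 + wnorm ρ q / 2 := add_le_add h3 h3
        _ = wnorm ρ q := ENNReal.add_halves _
        _ = wnorm ρ q + 0 := (add_zero _).symm
    exact nonpos_iff_eq_zero.mp (ENNReal.le_of_add_le_add_left hq.ne h5)
  have hq0 : q = 0 := eq_zero_of_wnorm_eq_zero hρ h4
  refine ⟨hq0, ?_⟩
  rw [hq0, zero_mul, zero_add] at h
  exact h

end Contraction

/-! ### 4. The Weierstrass division theorem -/

section Division

variable [CompleteSpace 𝕜]

/-- A small multiplier: for `M < ∞` and `ε > 0` there is `0 < t ≤ 1` with `t M < ε`. [folklore] -/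
theorem exists_coe_mul_lt {M ε : ℝ≥0∞} (hM : M < ⊤) (hε : 0 < ε) :
    ∃ t : ℝ≥0, 0 < t ∧ t ≤ 1 ∧ (t : ℝ≥0∞) * M < ε := by
  by_cases hεtop : ε = ⊤
  · refine ⟨1, one_pos, le_rfl, ?_⟩
    rw [hεtop, ENNReal.coe_one, one_mul]; exact hM
  set m : ℝ≥0 := M.toNNReal
  have hMeq : M = m := (ENNReal.coe_toNNReal hM.ne).symm
  set e : ℝ≥0 := ε.toNNReal
  have heeq : ε = e := (ENNReal.coe_toNNReal hεtop).symm
  have hepos : 0 < e := by rw [heeq] at hε; exact_mod_cast hε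
  refine ⟨min 1 (e / (2 * (m + 1))), lt_min one_pos (div_pos hepos (by positivity)), min_le_left _ _, ?_⟩
  rw [hMeq, heeq, ← ENNReal.coe_mul, ENNReal.coe_lt_coe]
  calc min 1 (e / (2 * (m + 1))) * m ≤ e / (2 * (m + 1)) * (m + 1) :=
        mul_le_mul (min_le_right _ _) (le_add_of_nonneg_right zero_le) zero_le zero_le
    _ = e / 2 := by field_simp
    _ < e := NNReal.half_lt_self hepos.ne'

/-- **Weierstrass division theorem** (Grauert–Remmert, Kap. I §4, Satz 3; Stickelberger form).
Let `g ∈ B_{ρ₀}` be regular in `T = X none` of order `d`. Then there is a positive polyradius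
`ρ ≤ ρ₀` such that every `f ∈ B_ρ` is `f = q g + r` with `q, r ∈ B_ρ` and `r` a polynomial in
`T` of degree `< d`, and such a representation with `q ∈ B_ρ` is unique.
[cite: GrauertRemmert1971, Kap. I §4, Satz 3] -/
theorem weierstrass_division {ρ₀ : Option σ → ℝ≥0} (hρ₀ : ∀ o, 0 < ρ₀ o)
    {g : MvPowerSeries (Option σ) 𝕜} {d : ℕ} (hg : wnorm ρ₀ g < ⊤) (hreg : IsTRegular d g) :
    ∃ ρ : Option σ → ℝ≥0, (∀ o, 0 < ρ o) ∧ (∀ o, ρ o ≤ ρ₀ o) ∧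
      (∀ f, wnorm ρ f < ⊤ → ∃ q r : MvPowerSeries (Option σ) 𝕜,
        wnorm ρ q < ⊤ ∧ wnorm ρ r < ⊤ ∧ IsTPoly d r ∧ f = q * g + r) ∧
      (∀ q r : MvPowerSeries (Option σ) 𝕜, wnorm ρ q < ⊤ → IsTPoly d r → q * g + r = 0 →
        q = 0 ∧ r = 0) := by
  have hr₀ : ρ₀ none ≠ 0 := (hρ₀ none).ne'
  -- `g = T^d e + b`, `e` a unit, `b` vanishing at `x' = 0`
  set e := highT d g with he_def
  set b := lowT d g with hb_def
  have he0 : constantCoeff e ≠ 0 := by rw [he_def, constantCoeff_highT]; exact hreg.2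
  have hefin : wnorm ρ₀ e < ⊤ :=
    (wnorm_highT_le hr₀ d g).trans_lt (ENNReal.div_lt_top hg.ne (pow_ne_zero _ (ENNReal.coe_ne_zero.mpr hr₀)))
  have hbV : VanishesOnT b := hreg.vanishesOnT_lowT
  -- Step 1: shrink isotropically so that `e⁻¹ ∈ B_{ρ₁}`
  obtain ⟨t₁, ht₁, ht₁1, heinv⟩ := exists_wnorm_inv_lt_top hefin he0
  set ρ₁ : Option σ → ℝ≥0 := fun o => t₁ * ρ₀ o with hρ₁_def
  have hρ₁ : ∀ o, 0 < ρ₁ o := fun o => mul_pos ht₁ (hρ₀ o)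
  have hρ₁le : ∀ o, ρ₁ o ≤ ρ₀ o := fun o => mul_le_of_le_one_left zero_le ht₁1
  -- `w = -(b e⁻¹)` vanishes at `x' = 0` and lies in `B_{ρ₁}`
  set w : MvPowerSeries (Option σ) 𝕜 := -(b * e⁻¹) with hw_def
  have hwV : VanishesOnT w := (hbV.mul_right _).neg
  have hbfin : wnorm ρ₁ b < ⊤ :=
    (wnorm_lowT_le ρ₁ d g).trans_lt (wnorm_lt_top_mono hρ₁le hg)
  have hwfin₁ : wnorm ρ₁ w < ⊤ := by
    rw [hw_def, wnorm_neg]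
    exact (wnorm_mul_le ρ₁ b _).trans_lt (ENNReal.mul_lt_top hbfin heinv)
  -- Step 2: shrink the `x'`-radii so that `‖w‖ ≤ r^d / 2`, `r = ρ₁ none`
  have hεpos : (0 : ℝ≥0∞) < (ρ₁ none : ℝ≥0∞) ^ d / 2 :=
    ENNReal.div_pos (pow_ne_zero _ (ENNReal.coe_ne_zero.mpr (hρ₁ none).ne')) (by simp)
  obtain ⟨t₂, ht₂, ht₂1, hlt⟩ := exists_coe_mul_lt hwfin₁ hεpos
  set ρ : Option σ → ℝ≥0 := scaleSome t₂ ρ₁ with hρ_def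
  have hρ : ∀ o, 0 < ρ o := scaleSome_pos ht₂ hρ₁
  have hρle₁ : ∀ o, ρ o ≤ ρ₁ o := scaleSome_le ht₂1 ρ₁
  have hρle : ∀ o, ρ o ≤ ρ₀ o := fun o => (hρle₁ o).trans (hρ₁le o)
  have hw : wnorm ρ w ≤ (ρ none : ℝ≥0∞) ^ d / 2 := by
    rw [hρ_def, scaleSome_none]
    exact ((wnorm_scaleSome_le ht₂1 ρ₁ hwV).trans hlt.le)
  have hwfin : wnorm ρ w < ⊤ := wnorm_lt_top_mono hρle₁ hwfin₁
  have heinvρ : wnorm ρ e⁻¹ < ⊤ := wnorm_lt_top_mono hρle₁ heinv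
  have heρ : wnorm ρ e < ⊤ := wnorm_lt_top_mono hρle hefin
  -- the key identity `g = e (T^d - w)`
  have hge : g = e * ((X none : MvPowerSeries (Option σ) 𝕜) ^ d - w) := by
    have h1 := lowT_add_X_pow_mul_highT d g
    rw [← he_def, ← hb_def] at h1
    rw [hw_def, sub_neg_eq_add, mul_add, ← mul_assoc, mul_comm e b, mul_assoc,
      MvPowerSeries.mul_inv_cancel e he0, mul_one, ← h1]
    ring
  refine ⟨ρ, hρ, hρle, fun f hf => ?_, fun q r hq hr h => ?_⟩
  · -- existence
    obtain ⟨hdiv, hq', hr', hpoly⟩ := division_sub hρ hw hwfin hf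
    set q' := divSol d w f
    set r := lowT d (f + q' * w)
    refine ⟨q' * e⁻¹, r, ?_, hr', hpoly, ?_⟩
    · exact (wnorm_mul_le ρ _ _).trans_lt (ENNReal.mul_lt_top hq' heinvρ)
    · rw [hge, mul_assoc, ← mul_assoc e⁻¹ e, MvPowerSeries.inv_mul_cancel e he0, one_mul]
      exact hdiv
  · -- uniqueness
    have h1 : (q * e) * ((X none : MvPowerSeries (Option σ) 𝕜) ^ d - w) + r = 0 := by
      rw [mul_assoc, ← hge]; exact h
    have hqe : wnorm ρ (q * e) < ⊤ := (wnorm_mul_le ρ _ _).trans_lt (ENNReal.mul_lt_top hq heρ)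
    obtain ⟨hqe0, hr0⟩ := division_sub_unique_zero hρ hw hqe hr h1
    refine ⟨?_, hr0⟩
    have := congrArg (· * e⁻¹) hqe0
    simpa only [mul_assoc, MvPowerSeries.mul_inv_cancel e he0, mul_one, zero_mul] using this

/-- **Weierstrass division for germs**: if `g` is convergent and regular in `T` of order `d`,
every convergent `f` is `q g + r` with `q, r` convergent and `r` of `T`-degree `< d`.
[cite: GrauertRemmert1971, Kap. I §4, Satz 3] -/
theorem exists_weierstrass_division {g f : MvPowerSeries (Option σ) 𝕜} {d : ℕ}
    (hg : HasPosRadius g) (hreg : IsTRegular d g) (hf : HasPosRadius f) :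
    ∃ q r : MvPowerSeries (Option σ) 𝕜,
      HasPosRadius q ∧ HasPosRadius r ∧ IsTPoly d r ∧ f = q * g + r := by
  obtain ⟨ρ₀, hρ₀, hg₀, hf₀⟩ := hg.exists_common hf
  obtain ⟨ρ, hρ, hρle, hex, -⟩ := weierstrass_division hρ₀ hg₀ hreg
  obtain ⟨q, r, hq, hr, hpoly, h⟩ := hex f (wnorm_lt_top_mono hρle hf₀)
  exact ⟨q, r, ⟨ρ, hρ, hq⟩, ⟨ρ, hρ, hr⟩, hpoly, h⟩

/-- **Uniqueness of Weierstrass division for germs**: the quotient and the remainder are unique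
among representations `f = q g + r` with `q` convergent and `r` of `T`-degree `< d`.
[cite: GrauertRemmert1971, Kap. I §4, Satz 3] -/
theorem weierstrass_division_unique {g : MvPowerSeries (Option σ) 𝕜} {d : ℕ}
    (hg : HasPosRadius g) (hreg : IsTRegular d g) {q r q' r' : MvPowerSeries (Option σ) 𝕜}
    (hq : HasPosRadius q) (hq' : HasPosRadius q') (hr : IsTPoly d r) (hr' : IsTPoly d r')
    (h : q * g + r = q' * g + r') : q = q' ∧ r = r' := by
  obtain ⟨ρ₁, hρ₁, hg₁, hq₁⟩ := hg.exists_common hq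
  obtain ⟨ρ₂, hρ₂, hg₂, hq₂⟩ := hg.exists_common hq'
  set ρ₀ : Option σ → ℝ≥0 := fun o => min (ρ₁ o) (ρ₂ o)
  have hρ₀ : ∀ o, 0 < ρ₀ o := fun o => lt_min (hρ₁ o) (hρ₂ o)
  obtain ⟨ρ, hρ, hρle, -, huniq⟩ := weierstrass_division hρ₀
    (wnorm_lt_top_mono (fun o => min_le_left _ _) hg₁) hreg
  have hqq : wnorm ρ (q - q') < ⊤ :=
    (wnorm_sub_le ρ q q').trans_lt (ENNReal.add_lt_top.mpr
      ⟨wnorm_lt_top_mono (fun o => (hρle o).trans (min_le_left _ _)) hq₁,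
       wnorm_lt_top_mono (fun o => (hρle o).trans (min_le_right _ _)) hq₂⟩)
  have h0 : (q - q') * g + (r - r') = 0 := by
    rw [sub_mul, ← sub_eq_zero.mpr h]; ring
  obtain ⟨h1, h2⟩ := huniq _ _ hqq (hr.sub hr') h0
  exact ⟨sub_eq_zero.mp h1, sub_eq_zero.mp h2⟩

end Division

/-! ### 5. The Weierstrass preparation theorem -/

section Preparation

variable {R : Type*} [CommRing R]

/-- **Reduction modulo `x'`**: the ring homomorphism `F ↦ F(T, 0) ∈ R⟦T⟧` picking the pure-`T`
coefficients. [cite: GrauertRemmert1971, Kap. I §4] -/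
def redT : MvPowerSeries (Option σ) R →+* PowerSeries R where
  toFun F := PowerSeries.mk fun k => coeff (single none k) F
  map_one' := by
    classical
    ext k
    rw [PowerSeries.coeff_mk, coeff_one, PowerSeries.coeff_one]
    simp only [Finsupp.single_eq_zero]
  map_mul' F G := by
    classical
    ext k
    rw [PowerSeries.coeff_mk, coeff_mul, Finsupp.antidiagonal_single, Finset.sum_map,
      PowerSeries.coeff_mul]
    refine Finset.sum_congr rfl fun p _ => ?_
    simp [PowerSeries.coeff_mk]
  map_zero' := by ext k; simp
  map_add' F G := by ext k; simp

/-- Coefficients of `redT`. [folklore] -/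
@[simp] theorem coeff_redT (F : MvPowerSeries (Option σ) R) (k : ℕ) :
    PowerSeries.coeff k (redT F) = coeff (single none k) F := by
  rw [redT, RingHom.coe_mk, MonoidHom.coe_mk, OneHom.coe_mk, PowerSeries.coeff_mk]

/-- `redT T = X`. [folklore] -/
theorem redT_X_none : redT (X none : MvPowerSeries (Option σ) R) = PowerSeries.X := by
  classical
  ext k
  rw [coeff_redT, coeff_X, PowerSeries.coeff_X]
  by_cases hk : k = 1
  · subst hk; simp
  · rw [if_neg hk, if_neg]
    intro h
    apply hk
    have := congrArg (fun f : Option σ →₀ ℕ => f none) h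
    simpa using this

/-- `redT F = 0` iff `F` vanishes at `x' = 0`. [folklore] -/
theorem redT_eq_zero_iff (F : MvPowerSeries (Option σ) R) : redT F = 0 ↔ VanishesOnT F := by
  constructor
  · intro h k
    have := congrArg (PowerSeries.coeff k) h
    rwa [coeff_redT, map_zero] at this
  · intro h; ext k; rw [coeff_redT, h k, map_zero]

/-- The constant coefficient of `redT F` is that of `F`. [folklore] -/
theorem constantCoeff_redT (F : MvPowerSeries (Option σ) R) :
    PowerSeries.constantCoeff (redT F) = constantCoeff F := by
  rw [← PowerSeries.coeff_zero_eq_constantCoeff_apply, coeff_redT, Finsupp.single_zero,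
    coeff_zero_eq_constantCoeff_apply]

/-- For a `T`-regular `g` of order `d`: `redT g = X^d · E` with `E(0) = ` the `T^d`-coefficient.
[folklore] -/
theorem redT_eq_X_pow_mul {d : ℕ} {g : MvPowerSeries (Option σ) R} (hg : IsTRegular d g) :
    redT g = PowerSeries.X ^ d * PowerSeries.mk fun k => coeff (single none (k + d)) g := by
  ext k
  rw [coeff_redT, PowerSeries.coeff_X_pow_mul']
  by_cases hk : d ≤ k
  · rw [if_pos hk, PowerSeries.coeff_mk, tsub_add_cancel_of_le hk]
  · rw [if_neg hk, hg.1 k (not_le.mp hk)]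

/-- A `T`-polynomial of degree `< d` reduces to a polynomial of degree `< d`. [folklore] -/
theorem coeff_redT_eq_zero_of_isTPoly {d : ℕ} {r : MvPowerSeries (Option σ) R} (hr : IsTPoly d r)
    {k : ℕ} (hk : d ≤ k) : PowerSeries.coeff k (redT r) = 0 := by
  rw [coeff_redT]; exact hr _ (by simpa using hk)

/-- **Key step of the preparation theorem**: dividing `T^d` by a `T`-regular `g` of order `d`,
`T^d = q g + r`, the quotient `q` is a unit and `r` vanishes at `x' = 0`.
[cite: GrauertRemmert1971, Kap. I §4, Satz 4] -/
theorem isUnit_and_vanishesOnT_of_X_pow_eq {d : ℕ} {g q r : MvPowerSeries (Option σ) 𝕜}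
    (hg : IsTRegular d g) (hr : IsTPoly d r)
    (h : (X none : MvPowerSeries (Option σ) 𝕜) ^ d = q * g + r) :
    constantCoeff q ≠ 0 ∧ VanishesOnT r := by
  set E : PowerSeries 𝕜 := PowerSeries.mk fun k => coeff (single none (k + d)) g with hE
  have hE0 : PowerSeries.constantCoeff E ≠ 0 := by
    rw [← PowerSeries.coeff_zero_eq_constantCoeff_apply, hE, PowerSeries.coeff_mk, zero_add]
    exact hg.2
  have hred := congrArg redT h
  rw [map_pow, redT_X_none, map_add, map_mul, redT_eq_X_pow_mul hg, ← hE] at hred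
  -- `redT r = 0`: its coefficients below `d` vanish by comparing, above `d` by `IsTPoly`
  have hr0 : redT r = 0 := by
    ext k
    rw [map_zero]
    by_cases hk : d ≤ k
    · exact coeff_redT_eq_zero_of_isTPoly hr hk
    · have := congrArg (PowerSeries.coeff k) hred
      rw [PowerSeries.coeff_X_pow, if_neg (fun h' => hk h'.symm.le), map_add,
        ← mul_assoc, mul_comm (redT q), mul_assoc, PowerSeries.coeff_X_pow_mul', if_neg hk,
        zero_add] at this
      exact this.symm
  refine ⟨?_, (redT_eq_zero_iff r).mp hr0⟩
  rw [hr0, add_zero, ← mul_assoc, mul_comm (redT q), mul_assoc] at hred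
  -- `X^d = X^d * (redT q * E)` ⇒ `redT q * E = 1`
  have h1 : (PowerSeries.X : PowerSeries 𝕜) ^ d * (1 - redT q * E) = 0 := by
    rw [mul_sub, mul_one, ← hred, sub_self]
  have h2 : redT q * E = 1 := by
    rcases mul_eq_zero.mp h1 with h3 | h3
    · exact absurd h3 (pow_ne_zero _ PowerSeries.X_ne_zero)
    · exact (sub_eq_zero.mp h3).symm
  have h3 := congrArg PowerSeries.constantCoeff h2
  rw [map_mul, map_one, constantCoeff_redT] at h3
  exact left_ne_zero_of_mul_eq_one h3

variable [CompleteSpace 𝕜]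

/-- **Weierstrass preparation theorem** (Grauert–Remmert, Kap. I §4, Satz 4): a convergent power
series `g` regular in `T` of order `d` is `g = u · (T^d + b)` with `u` a convergent unit and `b`
a convergent polynomial in `T` of degree `< d` whose coefficients vanish at `x' = 0` (so
`T^d + b` is a Weierstrass polynomial). [cite: GrauertRemmert1971, Kap. I §4, Satz 4] -/
theorem exists_weierstrass_preparation {g : MvPowerSeries (Option σ) 𝕜} {d : ℕ}
    (hg : HasPosRadius g) (hreg : IsTRegular d g) :
    ∃ u b : MvPowerSeries (Option σ) 𝕜, HasPosRadius u ∧ constantCoeff u ≠ 0 ∧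
      HasPosRadius b ∧ IsTPoly d b ∧ VanishesOnT b ∧
      g = u * ((X none : MvPowerSeries (Option σ) 𝕜) ^ d + b) := by
  obtain ⟨q, r, hq, hr, hpoly, h⟩ :=
    exists_weierstrass_division hg hreg ((HasPosRadius.X none).pow d)
  obtain ⟨hq0, hrV⟩ := isUnit_and_vanishesOnT_of_X_pow_eq hreg hpoly h
  refine ⟨q⁻¹, -r, hq.inv hq0, ?_, hr.neg, hpoly.neg, hrV.neg, ?_⟩
  · rw [MvPowerSeries.constantCoeff_inv]; exact inv_ne_zero hq0
  · -- `T^d - r = q g` ⇒ `g = q⁻¹ (T^d - r)`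
    have h1 : (X none : MvPowerSeries (Option σ) 𝕜) ^ d + -r = q * g := by rw [h]; ring
    rw [h1, ← mul_assoc, MvPowerSeries.inv_mul_cancel q hq0, one_mul]

end Preparation

end Literature.RingTheory.MvPowerSeries
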